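import Summits.CriticalPhenomena.CardyFormulaZ2.Theorems.CardyRotToConfR2SymmetryUpgrade.Negative.SurgFatMarkovKernel
import Mathlib.LinearAlgebra.AffineSpace.FiniteDimensional
import HarnessLib

/-!
# Slit configurations pin a traced segment
# (stub `stub_slitTrace`, line `germ-label-transport`, crux `stmt-CriticalPhenomena-0698`)

Stub `stub_slitTrace` of the lead's skeleton
(`Cruxes/CardyRotToConfR2SymmetryUpgrade/GermLabelTransport`), a deterministic curve lemma consumed
by the proof of the domain Markov property of the fat-germ one-shot surgery. If the typed remaining
domain `remainingDomain D (stopAt F γ)` of a stopped past (with `γ.source = D.pt 0`) is the mid-chord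
slit configuration `D₁ ∖ [a₁, z]` of a firing Dobrushin domain `D₁`, the tip `z = fireChord D₁ s`
lying on the OPEN chord (`0 < s < 1`), and the tip of the stopped past is `z`, then the chosen
representative `c = γ.out` traces a non-degenerate straight segment.

Proof. Let `T` be the hitting parameter of `F` by `c`, so that `stopAt F γ = mk (c.stopAt F)`,
`c T = z`, and every point `c t`, `t ≤ T`, lies on the trace of the stopped past, hence outside the
remaining domain `D₁ ∖ [a₁, z]`: such a point lying in `D₁` lies on the segment `[a₁, z]` (★).
* `c` is not identically `z` on `[0, T]`: otherwise the stopped past is the constant class at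
  `z = γ.source = D.pt 0`, its remaining domain is `D.carrier` (`remainingDomain_mk_const`), and
  `(D₁ ∖ [a₁, z]; z, D.pt 1)` would be a Dobrushin configuration, contradicting
  `Negative.not_isJordanConfig_of_slit`.
* Let `u ≤ T` be the supremum of the parameters `t ≤ T` with `c t ≠ z`. Then `c = z` on `(u, T]`,
  so `c u = z ∈ D₁` (continuity), so `c` stays inside the open set `D₁` on a neighbourhood of `u`,
  which contains a parameter `t₁ < u` with `c t₁ ≠ z`. By (★) the sub-arc `c[t₁, u]` lies on the
  segment `[a₁, z]` (collinear) and contains the two distinct points `c t₁`, `z`.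

References: W. Werner, *Lectures on two-dimensional critical percolation* (2007), §3.2 (domain
Markov property); M. Aizenman, A. Burchard, Duke Math. J. 99 (1999), §2.1 (curve space).
-/

noncomputable section

open Set Filter Topology Metric

namespace Summit.CriticalPhenomena.CardyFormulaZ2.Theorems.CardyRotToConfR2SymmetryUpgrade

open Literature.Probability.RandomPlanarGeometry
open Summit.CriticalPhenomena.CardyFormulaZ2.Theorems.CardyRotToConfR2SymmetryUpgrade.Negative

namespace SlitTrace

/-- A closed segment of the plane is a collinear set. [folklore] -/
theorem collinear_segment (a b : ℂ) : Collinear ℝ (segment ℝ a b) := by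
  rw [collinear_iff_exists_forall_eq_smul_vadd]
  refine ⟨a, b - a, fun p hp => ?_⟩
  rw [segment_eq_image'] at hp
  obtain ⟨θ, -, rfl⟩ := hp
  exact ⟨θ, by rw [vadd_eq_add, add_comm]⟩

/-- Points of the initial piece `c[0, T]` (`T` the hitting parameter of `F`) lie on the trace of
the stopped curve `c.stopAt F`. [folklore] -/
theorem apply_mem_range_stopAt (F : Set ℂ) (c : Curve ℂ) {t : unitInterval}
    (ht : (t : ℝ) ≤ c.hitParam F) : c t ∈ (c.stopAt F).range := by
  rw [Curve.mem_range]
  rcases (c.hitParam_mem_Icc F).1.eq_or_lt with hT0 | hT0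
  · -- `T = 0`, so `t = 0`
    have ht0 : t = 0 := Subtype.ext (le_antisymm (ht.trans hT0.symm.le) t.2.1)
    refine ⟨0, ?_⟩
    rw [ht0, ← Curve.source_def, ← Curve.source_def, Curve.source_stopAt]
  · refine ⟨⟨t / c.hitParam F, div_nonneg t.2.1 hT0.le, div_le_one_of_le₀ ht hT0.le⟩, ?_⟩
    rw [Curve.stopAt_apply]
    congr 1
    rw [Subtype.coe_mk, mul_div_cancel₀ _ hT0.ne', Set.projIcc_val]

end SlitTrace

open SlitTrace in
/-- **S7g.** Slit configurations pin a traced segment (deterministic): if the typed remaining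
domain of a stopped past `stopAt F γ` in `D` is a mid-chord slit configuration `D₁ ∖ [a₁, z]` of a
firing domain `D₁` with the tip `z` on the open chord, then some representative of `γ` traces a
non-degenerate straight segment (its final approach to `z` runs inside `D₁ ∩ range ⊆ [a₁, z]`).
[folklore] -/
theorem stub_slitTrace : ∀ (D D₁ : DobrushinDomain) (F : Set ℂ), IsClosed F → Summit.CriticalPhenomena.CardyFormulaZ2.Theorems.CardyRotToConfR2SymmetryUpgrade.Negative.Fires D₁.carrier (D₁.pt 0) → ∀ s : unitInterval, 0 < (s : ℝ) → (s : ℝ) < 1 → ∀ γ : CurveClass ℂ, γ.source = D.pt 0 → remainingDomain D (CurveClass.stopAt F γ) = D₁.carrier \ segment ℝ (D₁.pt 0) (Summit.CriticalPhenomena.CardyFormulaZ2.Theorems.CardyRotToConfR2SymmetryUpgrade.Negative.fireChord D₁ s) → (CurveClass.stopAt F γ).target = Summit.CriticalPhenomena.CardyFormulaZ2.Theorems.CardyRotToConfR2SymmetryUpgrade.Negative.fireChord D₁ s → ∃ c : Curve ℂ, CurveClass.mk c = γ ∧ ∃ s' t' : unitInterval, s' < t' ∧ Collinear ℝ (c ''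 Set.Icc s' t') ∧ ¬ (c '' Set.Icc s' t').Subsingleton := by
  intro D D₁ F _ h s hs0 hs1 γ hsrc hV htgt
  set z : ℂ := fireChord D₁ s
  set c : Curve ℂ := γ.out
  have hT : c.hitParam F ∈ Icc (0 : ℝ) 1 := c.hitParam_mem_Icc F
  set T : ℝ := c.hitParam F
  have hp : CurveClass.stopAt F γ = CurveClass.mk (c.stopAt F) := rfl
  refine ⟨c, CurveClass.mk_out γ, ?_⟩
  -- (A) the tip of the stopped past is `c T = z`
  have hcT : c ⟨T, hT⟩ = z := by
    rw [hp, CurveClass.target_mk, Curve.target_stopAt] at htgt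
    exact htgt
  have hzD : z ∈ D₁.carrier := fireChord_mem_carrier h hs0 hs1
  -- (★) points of `c[0, T]` inside `D₁` lie on the segment
  have hB : ∀ t : unitInterval, (t : ℝ) ≤ T → c t ∈ D₁.carrier → c t ∈ segment ℝ (D₁.pt 0) z := by
    intro t ht htD
    by_contra hseg
    have hmem : c t ∈ remainingDomain D (CurveClass.stopAt F γ) := by
      rw [hV]
      exact ⟨htD, hseg⟩
    have hrange : c t ∈ (CurveClass.stopAt F γ).range := by
      rw [hp, CurveClass.range_mk]
      exact apply_mem_range_stopAt F c ht
    exact (remainingDomain_subset D _ hmem).2 hrange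
  -- (C) `c` is not identically `z` on `[0, T]`
  have hC : ∃ t : unitInterval, (t : ℝ) ≤ T ∧ c t ≠ z := by
    by_contra hall
    push Not at hall
    have hconst : c.stopAt F = Curve.const z := by
      refine Curve.ext (ContinuousMap.ext fun u => ?_)
      rw [Curve.coe_toContinuousMap, Curve.coe_toContinuousMap, Curve.stopAt_apply,
        Curve.const_apply]
      refine hall _ ?_
      rw [Set.coe_projIcc]
      exact max_le hT.1 ((min_le_right _ _).trans (mul_le_of_le_one_right hT.1 u.2.2))
    have hz0 : z = D.pt 0 := by
      rw [← hsrc, ← CurveClass.source_stopAt F γ, hp, hconst, CurveClass.source_mk,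
        Curve.source_def, Curve.const_apply]
    have hcarr : D.carrier = D₁.carrier \ segment ℝ (D₁.pt 0) z := by
      rw [← hV, hp, hconst, hz0, remainingDomain_mk_const]
    exact not_isJordanConfig_of_slit h hs0 hs1 (b := D.pt 1) ⟨D, hcarr, hz0.symm, rfl⟩
  -- Step 2: the supremum `u` of the parameters `t ≤ T` with `c t ≠ z`
  set A : Set ℝ := {t : ℝ | ∃ ht : t ∈ unitInterval, t ≤ T ∧ c ⟨t, ht⟩ ≠ z}
  obtain ⟨t₀, ht₀T, ht₀z⟩ := hC
  have ht₀A : (t₀ : ℝ) ∈ A := ⟨t₀.2, ht₀T, ht₀z⟩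
  have hAne : A.Nonempty := ⟨t₀, ht₀A⟩
  have hAbdd : BddAbove A := ⟨T, fun t ⟨_, ht, _⟩ => ht⟩
  set u : ℝ := sSup A with hu
  have huT : u ≤ T := csSup_le hAne fun t ⟨_, ht, _⟩ => ht
  have hu0 : 0 ≤ u := t₀.2.1.trans (le_csSup hAbdd ht₀A)
  have huI : u ∈ unitInterval := ⟨hu0, huT.trans hT.2⟩
  -- on `(u, T]` the curve sits at `z`
  have h1 : ∀ t : unitInterval, u < t → (t : ℝ) ≤ T → c t = z := by
    intro t hut htT
    by_contra hne
    exact not_le.2 hut (le_csSup hAbdd ⟨t.2, htT, hne⟩)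
  -- hence `c u = z`
  have hcu : c ⟨u, huI⟩ = z := by
    by_contra hne
    obtain ⟨ε, hε, hεne⟩ := Metric.eventually_nhds_iff.1
      ((c.continuous.continuousAt (x := ⟨u, huI⟩)).eventually_ne hne)
    rcases huT.eq_or_lt with huT' | huT'
    · apply hne
      have : (⟨u, huI⟩ : unitInterval) = ⟨T, hT⟩ := Subtype.ext huT'
      rw [this, hcT]
    · -- a parameter slightly to the right of `u`
      have hmin := min_le_left (u + ε / 2) T
      have hut : u < min (u + ε / 2) T := lt_min (by linarith) huT'
      have htT : min (u + ε / 2) T ≤ T := min_le_right _ _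
      have htI : min (u + ε / 2) T ∈ unitInterval := ⟨hu0.trans hut.le, htT.trans hT.2⟩
      have hdist : dist (⟨min (u + ε / 2) T, htI⟩ : unitInterval) ⟨u, huI⟩ < ε := by
        rw [Subtype.dist_eq, Real.dist_eq, abs_lt]
        constructor <;> [linarith; linarith]
      exact hεne hdist (h1 ⟨_, htI⟩ hut htT)
  -- near `u` the curve is inside the open set `D₁`
  obtain ⟨δ, hδ, hδD⟩ : ∃ δ > 0, ∀ ⦃t : unitInterval⦄, dist t ⟨u, huI⟩ < δ → c t ∈ D₁.carrier :=
    Metric.eventually_nhds_iff.1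
      ((c.continuous.continuousAt (x := ⟨u, huI⟩)).eventually_mem (D₁.isOpen.mem_nhds (hcu ▸ hzD)))
  -- a parameter `t₁ < u` within `δ` of `u` with `c t₁ ≠ z`
  obtain ⟨t₁, ⟨ht₁I, ht₁T, ht₁z⟩, ht₁u⟩ :=
    exists_lt_of_lt_csSup hAne (show u - δ < sSup A by linarith)
  have ht₁le : t₁ ≤ u := le_csSup hAbdd ⟨ht₁I, ht₁T, ht₁z⟩
  have ht₁lt : t₁ < u := by
    refine lt_of_le_of_ne ht₁le fun heq => ht₁z ?_
    have : (⟨t₁, ht₁I⟩ : unitInterval) = ⟨u, huI⟩ := Subtype.ext heq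
    rw [this, hcu]
  -- the sub-arc `c[t₁, u]` lies on the segment
  have himg : c '' Icc (⟨t₁, ht₁I⟩ : unitInterval) ⟨u, huI⟩ ⊆ segment ℝ (D₁.pt 0) z := by
    rintro _ ⟨x, ⟨hx1, hx2⟩, rfl⟩
    have hx1' : t₁ ≤ (x : ℝ) := hx1
    have hx2' : (x : ℝ) ≤ u := hx2
    refine hB x (hx2'.trans huT) (hδD ?_)
    rw [Subtype.dist_eq, Real.dist_eq, abs_lt]
    constructor <;> [linarith; linarith]
  refine ⟨⟨t₁, ht₁I⟩, ⟨u, huI⟩, Subtype.mk_lt_mk.2 ht₁lt, (collinear_segment _ _).subset himg,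
    fun hsub => ht₁z ?_⟩
  have hm1 : c ⟨t₁, ht₁I⟩ ∈ c '' Icc (⟨t₁, ht₁I⟩ : unitInterval) ⟨u, huI⟩ :=
    mem_image_of_mem _ (left_mem_Icc.2 (Subtype.mk_le_mk.2 ht₁le))
  have hm2 : c ⟨u, huI⟩ ∈ c '' Icc (⟨t₁, ht₁I⟩ : unitInterval) ⟨u, huI⟩ :=
    mem_image_of_mem _ (right_mem_Icc.2 (Subtype.mk_le_mk.2 ht₁le))
  rw [hsub hm1 hm2, hcu]

end Summit.CriticalPhenomena.CardyFormulaZ2.Theorems.CardyRotToConfR2SymmetryUpgrade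

end
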